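import Summits.CriticalPhenomena.Ising3DConformalLimit.Theses.ReflectionTwin
import Summits.CriticalPhenomena.Ising3DConformalLimit.Theorems.ReflectionTwinTwinThresholdStrongSeamOrderDecoration
import Summits.CriticalPhenomena.Ising3DConformalLimit.Theorems.ReflectionTwinTwinThresholdStrongSeamOrderGeometry
import HarnessLib

/-!
# Stub `stub_strongSeamOrder` ((S) plane order at strong seam coupling)

Crux `TwinThreshold` (stmt-CriticalPhenomena-16906), line `seam_renewal`, route `ReflectionTwin`.

Registered stub of the checked skeleton `Cruxes/TwinThreshold/Lines/seam_renewal.lean`, proved EXACTLY as registered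
(`--supports stmt-CriticalPhenomena-16906`): there is a seam coupling `J ≥ 0` (namely `J₀ = 2/β_c(3)`) at which the
(111) reflection twin `TW(J₀)` of `ℤ³` at bulk `β_c(3)` has plane long-range order,
`∃ m > 0, ∀ c (h c = 0), m ≤ sup_L ⟨σ₀σ_c⟩^{free}_{TW(J₀), box L}`.

Proof (every step only LOWERS correlations, or is an identity; `isingTwoPoint_le_twin`). Fix a plane site
`c = (-p₀, p₀-p₁, p₁)`, `p ∈ box 2 N`, and the box `box 3 (2N+1)`. (i) Griffiths' comparison
(`TwoCouplingGKS.gibbsAvg_spinProduct_mono`): delete every bond of the twin except, for each square-lattice bond of the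
plane chart of `box 2 N`, the two bonds of its ONE decorating spin (layer `-1` for the `(1,0)`-bonds, nearest-neighbour
bonds; layer `+1` for the `(0,1)`-bonds, seam bonds; geometry file), each of coupling `β_c(3) J₀ = 2`.
(ii) Decoration–iteration (`gibbsAvg_decCoupling`, decoration file): summing the decorating spins gives the pair model
on the remaining sites with coupling `β₂ = decorK 2 = ½ log cosh 4` on the decorated bonds; the other sites are free
and integrate out (`EndpointIdentityProof.gibbsAvg_restrict`), and the plane chart `box 2 N ≃ plane sites`
(`PairIsing.gibbsAvg_comp_equiv`) identifies the result with the nearest-neighbour square-lattice model in `box 2 N`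
at `β₂` (up to symmetrisation of the coupling matrix, `gibbsAvg_symmHalf`, and one more Griffiths comparison), i.e.
with `isingTwoPoint (zdGraph 2) (box 2 N) β₂ 0 .free 0 p` (`gibbsAvg_nn2_pair`). (iii) `β₂ > β_c(2) = ½ log (1+√2)`
(`cosh 4 > 1 + √2`; `criticalBeta_two_holds`), so along `N → ∞` the planar box two-point function tends to
`⟨σ₀σ_p⟩^{free}_{β₂} = ⟨σ₀σ_p⟩⁺_{β₂} ≥ m*(β₂)² > 0` uniformly in `p` (`stub_strongSeamOrder_partD_planarOrder`:
BGJS duality identity, GKS, positivity of `m*` above `β_c(2)`), whence `m*(β₂)² ≤ sup_L ⟨σ₀σ_c⟩_{TW(J₀), box L}`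
for every plane site `c` (`c` is the chart point of `(-c₀, c₂)`).

References: R. B. Griffiths, J. Math. Phys. 8 (1967) 478; M. E. Fisher, Phys. Rev. 113 (1959) 969 (decoration);
G. Benettin, G. Gallavotti, G. Jona-Lasinio, A. L. Stella, Comm. Math. Phys. 30 (1973) 45, eq. (3.10); S. Friedli,
Y. Velenik, *Statistical Mechanics of Lattice Systems* (CUP 2017) §3.6–§3.8, §3.10.1, Exercise 3.31. No definitions,
no notation, no named-fact hypotheses, no `sorry`.
-/

noncomputable section

namespace Summit.CriticalPhenomena.Ising3DConformalLimit.Cruxes.TwinThreshold.SeamRenewal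

open scoped BigOperators Classical
open Filter Topology Finset
open Literature.Probability.LatticeModels
open Summit.CriticalPhenomena.Ising3DConformalLimit.Cruxes.ExistsScaleCovariantLimit.DecimationHomotopyRate

namespace StrongSeamOrder

/-- **One-box comparison (the heart of (S))**: for `p ∈ box 2 N`, the free planar two-point function
`⟨σ₀σ_p⟩^{free}_{box 2 N; β₂}`, `β₂ = decorK 2 = ½ log cosh 4`, is at most the box average of `σ₀ σ_c`,
`c = (-p₀, p₀-p₁, p₁)` the chart point of `p`, in the (111) reflection twin on `box 3 (2N+1)` at bulk `β_c(3)` and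
seam coupling `J₀ = 2/β_c(3)` (the coupling matrix of the crux, written verbatim). Chain: planar box bridge = ;
Griffiths (every bond of `box 2 N` is decorated) ≤ ; symmetrisation = ; transport along the plane chart = ;
marginalisation of the free spins = ; decoration–iteration = ; Griffiths (the decorated sub-model is dominated by the
twin) ≤ . [cite: FriedliVelenik2017, Exercise 3.31, p. 142] -/
theorem isingTwoPoint_le_twin (N : ℕ) {p : Site 2} (hp : p ∈ box 2 N) :
    isingTwoPoint (zdGraph 2) (box 2 N) (PairIsing.decorK 2) 0 .free 0 p ≤
      PairIsing.gibbsAvg (fun a b : ↥(box 3 (2 * N + 1)) =>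
          if (((∑ i, |a.1 i - b.1 i| = 1) ∧ ¬ ((a.1 0 + a.1 1 + a.1 2 = 0 ∧ b.1 0 + b.1 1 + b.1 2 = 1) ∨
              (a.1 0 + a.1 1 + a.1 2 = 1 ∧ b.1 0 + b.1 1 + b.1 2 = 0))) ∨
            (((a.1 0 + a.1 1 + a.1 2 = 0 ∧ b.1 0 + b.1 1 + b.1 2 = 1) ∨
                (a.1 0 + a.1 1 + a.1 2 = 1 ∧ b.1 0 + b.1 1 + b.1 2 = 0)) ∧
              ∃ i : Fin 3, a.1 + b.1 = Pi.single i 1)) then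
            (criticalBeta 3 / 2) * (if a.1 0 + a.1 1 + a.1 2 = 0 ∨ b.1 0 + b.1 1 + b.1 2 = 0 then 2 / criticalBeta 3 else 1)
          else 0)
        (fun s => ∏ i, if h : (![0, ![-(p 0), p 0 - p 1, p 1]] : Fin 2 → Site 3) i ∈ box 3 (2 * N + 1) then
          spinAt (⟨(![0, ![-(p 0), p 0 - p 1, p 1]] : Fin 2 → Site 3) i, h⟩ : ↥(box 3 (2 * N + 1))) s else 0) := by
  have hβc : 0 < criticalBeta 3 := criticalBeta_pos_holds (d := 3) (by norm_num)
  have hK : criticalBeta 3 / 2 * (2 / criticalBeta 3) = 1 := by field_simp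
  have hβ₂ : 0 ≤ PairIsing.decorK 2 := PairIsing.decorK_nonneg 2
  have h0p : (0 : Site 2) ∈ box 2 N := zero_mem_box 2 N
  have h0L : (0 : Site 3) ∈ box 3 (2 * N + 1) := zero_mem_box 3 _
  have hcL : (![-(p 0), p 0 - p 1, p 1] : Site 3) ∈ box 3 (2 * N + 1) := (plane_facts hp).1
  rw [twinObs_pair h0L hcL]
  /- VOCABULARY (proof-local abbreviations). `IsDec z`: `z` decorates a bond of the chart of `box 2 N` (lower: layer
  `-1`, `(-z₀-1, z₂) ∈ [-N,N-1]×[-N,N]`; upper: layer `+1`, `(z₀, -z₂) ∈ [-N,N]×[-N,N-1]`); `end1 z`, `end2 z`: its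
  two plane ends; `PlaneIn q`: `q` is a chart point of `box 2 N`. -/
  set IsDec : Site 3 → Prop := fun z =>
    (z 0 + z 1 + z 2 = -1 ∧ -(N : ℤ) ≤ -(z 0) - 1 ∧ -(z 0) ≤ (N : ℤ) ∧ -(N : ℤ) ≤ z 2 ∧ z 2 ≤ (N : ℤ)) ∨
      (z 0 + z 1 + z 2 = 1 ∧ -(N : ℤ) ≤ z 0 ∧ z 0 ≤ (N : ℤ) ∧ -(N : ℤ) ≤ -(z 2) ∧ -(z 2) + 1 ≤ (N : ℤ))
    with hIsDec
  set end1 : Site 3 → Site 3 := fun z =>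
    if z 0 + z 1 + z 2 = -1 then ![z 0 + 1, z 1, z 2] else ![-(z 0), 1 - z 1, -(z 2)] with hend1
  set end2 : Site 3 → Site 3 := fun z =>
    if z 0 + z 1 + z 2 = -1 then ![z 0, z 1 + 1, z 2] else ![-(z 0), -(z 1), 1 - z 2] with hend2
  set PlaneIn : Site 3 → Prop := fun q =>
    q 0 + q 1 + q 2 = 0 ∧ -(N : ℤ) ≤ -(q 0) ∧ -(q 0) ≤ (N : ℤ) ∧ -(N : ℤ) ≤ q 2 ∧ q 2 ≤ (N : ℤ)
    with hPlaneIn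
  -- geometry of the decorations (geometry file)
  have end_facts : ∀ z, IsDec z → (end1 z ∈ box 3 (2 * N + 1) ∧ end2 z ∈ box 3 (2 * N + 1)) ∧
      (PlaneIn (end1 z) ∧ PlaneIn (end2 z)) ∧ end1 z ≠ end2 z ∧
      ((z 0 + z 1 + z 2 = -1 ∧ (∑ i, |z i - end1 z i| = 1) ∧ (∑ i, |z i - end2 z i| = 1)) ∨
        (z 0 + z 1 + z 2 = 1 ∧ z + end1 z = Pi.single 1 1 ∧ z + end2 z = Pi.single 2 1)) := by
    intro z hD
    rcases hD with h | h
    · have hz : z 0 + z 1 + z 2 = -1 := h.1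
      simp only [hend1, hend2, hPlaneIn, if_pos hz]
      obtain ⟨hm, hP, hne, hs1, hs2⟩ := low_end_facts N z h
      exact ⟨hm, hP, hne, Or.inl ⟨hz, hs1, hs2⟩⟩
    · have hz : ¬ z 0 + z 1 + z 2 = -1 := by omega
      simp only [hend1, hend2, hPlaneIn, if_neg hz]
      obtain ⟨hm, hP, hne, hs1, hs2⟩ := up_end_facts N z h
      exact ⟨hm, hP, hne, Or.inr ⟨h.1, hs1, hs2⟩⟩
  have not_isDec_of_height : ∀ q : Site 3, q 0 + q 1 + q 2 = 0 → ¬ IsDec q := by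
    intro q hq hD
    rcases hD with h | h <;> omega
  -- the end maps on the box (identity off the decorations)
  set u : ↥(box 3 (2 * N + 1)) → ↥(box 3 (2 * N + 1)) := fun a =>
    if h : IsDec a.1 then ⟨end1 a.1, (end_facts a.1 h).1.1⟩ else a with hu
  set v : ↥(box 3 (2 * N + 1)) → ↥(box 3 (2 * N + 1)) := fun a =>
    if h : IsDec a.1 then ⟨end2 a.1, (end_facts a.1 h).1.2⟩ else a with hv
  have huv : ∀ a : ↥(box 3 (2 * N + 1)), IsDec a.1 → (u a).1 = end1 a.1 ∧ (v a).1 = end2 a.1 := by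
    intro a h
    rw [hu, hv]
    dsimp only
    rw [dif_pos h, dif_pos h]
    exact ⟨rfl, rfl⟩
  have huD : ∀ a : ↥(box 3 (2 * N + 1)), IsDec a.1 → ¬ IsDec (u a).1 := fun a h => by
    rw [(huv a h).1]; exact not_isDec_of_height _ (end_facts a.1 h).2.1.1.1
  have hvD : ∀ a : ↥(box 3 (2 * N + 1)), IsDec a.1 → ¬ IsDec (v a).1 := fun a h => by
    rw [(huv a h).2]; exact not_isDec_of_height _ (end_facts a.1 h).2.1.2.1
  have hune : ∀ a : ↥(box 3 (2 * N + 1)), IsDec a.1 → u a ≠ v a := fun a h hne => by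
    have h2 := congrArg Subtype.val hne
    rw [(huv a h).1, (huv a h).2] at h2
    exact (end_facts a.1 h).2.2.1 h2
  -- a decorated bond: the end `b` of the decoration `a` is a plane site bonded to `a`
  have hbond : ∀ a b : ↥(box 3 (2 * N + 1)), IsDec a.1 ∧ (b = u a ∨ b = v a) → b.1 0 + b.1 1 + b.1 2 = 0 ∧
      ((a.1 0 + a.1 1 + a.1 2 = -1 ∧ ∑ i, |a.1 i - b.1 i| = 1) ∨
        (a.1 0 + a.1 1 + a.1 2 = 1 ∧ ∃ i : Fin 3, a.1 + b.1 = Pi.single i 1)) := by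
    rintro a b ⟨hD, hb⟩
    obtain ⟨-, ⟨hP1, hP2⟩, -, hgeo⟩ := end_facts a.1 hD
    rcases hb with hb | hb
    · have hb1 : b.1 = end1 a.1 := by rw [hb]; exact (huv a hD).1
      rw [hb1]
      refine ⟨hP1.1, hgeo.imp (fun h => ⟨h.1, h.2.1⟩) (fun h => ⟨h.1, 1, h.2.1⟩)⟩
    · have hb2 : b.1 = end2 a.1 := by rw [hb]; exact (huv a hD).2
      rw [hb2]
      refine ⟨hP2.1, hgeo.imp (fun h => ⟨h.1, h.2.2⟩) (fun h => ⟨h.1, 2, h.2.2⟩)⟩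
  -- (7) Griffiths: the decorated sub-model (every decoration bond has coupling `2 · (1/2) + … = 1 = β_c/2 · J₀`) ≤ twin
  obtain ⟨B, hB⟩ := TwoCouplingGKS.exists_prod_spinAt_eq_spinProduct (univ : Finset (Fin 2))
    (![⟨0, h0L⟩, ⟨![-(p 0), p 0 - p 1, p 1], hcL⟩] : Fin 2 → ↥(box 3 (2 * N + 1)))
  have hobs3 : (fun s : SpinConfig ↥(box 3 (2 * N + 1)) => spinAt (⟨0, h0L⟩ : ↥(box 3 (2 * N + 1))) s *
      spinAt (⟨![-(p 0), p 0 - p 1, p 1], hcL⟩ : ↥(box 3 (2 * N + 1))) s) = spinProduct B := by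
    rw [← hB]
    funext s
    simp [Fin.prod_univ_two]
  rw [hobs3]
  refine le_trans ?_ (TwoCouplingGKS.gibbsAvg_spinProduct_mono
    (c' := fun a b : ↥(box 3 (2 * N + 1)) => (if IsDec a.1 ∧ (b = u a ∨ b = v a) then (2 : ℝ) / 2 else 0) +
      (if IsDec b.1 ∧ (a = u b ∨ a = v b) then (2 : ℝ) / 2 else 0)) (fun a b => ?_) B)
  swap
  · by_cases h1 : IsDec a.1 ∧ (b = u a ∨ b = v a)
    · by_cases h2 : IsDec b.1 ∧ (a = u b ∨ a = v b)
      · exact absurd h2.1 (h1.2.elim (fun hb => hb ▸ huD a h1.1) (fun hb => hb ▸ hvD a h1.1))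
      · obtain ⟨hb0, hgeo⟩ := hbond a b h1
        have hAdj := hgeo.elim (fun h => twinAdj_of_nn h.2 h.1) (fun h => Exists.elim h.2 fun i hi => twinAdj_of_seam h.1 i hi)
        rw [if_pos h1, if_neg h2, add_zero, if_pos hAdj,
          if_pos (show a.1 0 + a.1 1 + a.1 2 = 0 ∨ b.1 0 + b.1 1 + b.1 2 = 0 from Or.inr hb0), hK]
        norm_num
    · by_cases h2 : IsDec b.1 ∧ (a = u b ∨ a = v b)
      · obtain ⟨ha0, hgeo⟩ := hbond b a h2
        have hAdj := twinAdj_symm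
          (hgeo.elim (fun h => twinAdj_of_nn h.2 h.1) (fun h => Exists.elim h.2 fun i hi => twinAdj_of_seam h.1 i hi))
        rw [if_neg h1, if_pos h2, zero_add, if_pos hAdj,
          if_pos (show a.1 0 + a.1 1 + a.1 2 = 0 ∨ b.1 0 + b.1 1 + b.1 2 = 0 from Or.inl ha0), hK]
        norm_num
      · rw [if_neg h1, if_neg h2, add_zero, abs_zero]
        have := criticalBeta_nonneg 3
        split_ifs <;> positivity
  rw [← hobs3]
  /- the remaining sites: `Q = {a // ¬ IsDec a}` (non-decorations) ⊇ the chart `R = {q : Q // PlaneIn q}` of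
  `box 2 N`; observables `σ₀σ_c` on each; effective couplings `cQ` and their chart pull-back `cE` -/
  have h0D : ¬ IsDec (⟨0, h0L⟩ : ↥(box 3 (2 * N + 1))).1 := not_isDec_of_height _ (by simp)
  have hcD : ¬ IsDec (⟨![-(p 0), p 0 - p 1, p 1], hcL⟩ : ↥(box 3 (2 * N + 1))).1 :=
    not_isDec_of_height _ (height_plane p)
  have h0P : PlaneIn (0 : Site 3) := by
    simp only [hPlaneIn, Pi.zero_apply, add_zero, neg_zero, true_and]
    omega
  have hcP : PlaneIn ![-(p 0), p 0 - p 1, p 1] := (plane_facts hp).2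
  set q0 : {a : ↥(box 3 (2 * N + 1)) // ¬ IsDec a.1} := ⟨⟨0, h0L⟩, h0D⟩ with hq0
  set qc : {a : ↥(box 3 (2 * N + 1)) // ¬ IsDec a.1} := ⟨⟨![-(p 0), p 0 - p 1, p 1], hcL⟩, hcD⟩ with hqc
  set g : SpinConfig {a : ↥(box 3 (2 * N + 1)) // ¬ IsDec a.1} → ℝ := fun ρ => spinAt q0 ρ * spinAt qc ρ with hg
  set gR : SpinConfig {q : {a : ↥(box 3 (2 * N + 1)) // ¬ IsDec a.1} // PlaneIn q.1.1} → ℝ := fun τ =>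
    spinAt (⟨q0, h0P⟩ : {q : {a : ↥(box 3 (2 * N + 1)) // ¬ IsDec a.1} // PlaneIn q.1.1}) τ *
      spinAt (⟨qc, hcP⟩ : {q : {a : ↥(box 3 (2 * N + 1)) // ¬ IsDec a.1} // PlaneIn q.1.1}) τ with hgR
  set cQ : {a : ↥(box 3 (2 * N + 1)) // ¬ IsDec a.1} → {a : ↥(box 3 (2 * N + 1)) // ¬ IsDec a.1} → ℝ :=
    fun q q' => PairIsing.decorK 2 * ∑ z : {z : ↥(box 3 (2 * N + 1)) // IsDec z.1},
      if u z.1 = q.1 ∧ v z.1 = q'.1 then (1 : ℝ) else 0 with hcQ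
  set cE : ↥(box 2 N) → ↥(box 2 N) → ℝ := fun a b =>
    PairIsing.decorK 2 * ∑ z : {z : ↥(box 3 (2 * N + 1)) // IsDec z.1},
      if u z.1 = (⟨![-(a.1 0), a.1 0 - a.1 1, a.1 1], (plane_facts a.2).1⟩ : ↥(box 3 (2 * N + 1))) ∧
          v z.1 = (⟨![-(b.1 0), b.1 0 - b.1 1, b.1 1], (plane_facts b.2).1⟩ : ↥(box 3 (2 * N + 1))) then (1 : ℝ) else 0
    with hcE
  have hcE0 : ∀ a b, 0 ≤ cE a b := fun a b => mul_nonneg hβ₂ (Finset.sum_nonneg fun z _ => by positivity)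
  -- every bond of `box 2 N` is decorated: the effective coupling of a bond is at least `decorK 2`
  have hcE1 : ∀ (a b : ↥(box 2 N)) (i : Fin 2), b.1 = a.1 + Pi.single i 1 → PairIsing.decorK 2 ≤ cE a b := by
    intro a b i hab
    have hb : a.1 + Pi.single i 1 ∈ box 2 N := hab ▸ b.2
    obtain ⟨w, hwD, hwL, hw1, hw2⟩ : ∃ w : Site 3, IsDec w ∧ w ∈ box 3 (2 * N + 1) ∧
        end1 w = ![-(a.1 0), a.1 0 - a.1 1, a.1 1] ∧
        end2 w = ![-((a.1 + Pi.single i 1 : Site 2) 0), (a.1 + Pi.single i 1 : Site 2) 0 - (a.1 + Pi.single i 1 : Site 2) 1,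
          (a.1 + Pi.single i 1 : Site 2) 1] := by
      fin_cases i
      · obtain ⟨hD, hL, h1, h2⟩ := decLow_facts a.2 hb rfl
        refine ⟨_, Or.inl hD, hL, ?_, ?_⟩
        · simp only [hend1, if_pos hD.1]; exact h1
        · simp only [hend2, if_pos hD.1]; exact h2
      · obtain ⟨hD, hL, h1, h2⟩ := decUp_facts a.2 hb rfl
        have hz : ¬ ((![a.1 0, 1 - a.1 0 + a.1 1, -(a.1 1)] : Site 3) 0 + (![a.1 0, 1 - a.1 0 + a.1 1, -(a.1 1)] : Site 3) 1 +
            (![a.1 0, 1 - a.1 0 + a.1 1, -(a.1 1)] : Site 3) 2 = -1) := by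
          have := hD.1
          omega
        refine ⟨_, Or.inr hD, hL, ?_, ?_⟩
        · simp only [hend1, if_neg hz]; exact h1
        · simp only [hend2, if_neg hz]; exact h2
    have hle := Finset.single_le_sum (s := (univ : Finset {z : ↥(box 3 (2 * N + 1)) // IsDec z.1}))
      (f := fun z : {z : ↥(box 3 (2 * N + 1)) // IsDec z.1} =>
        if u z.1 = (⟨![-(a.1 0), a.1 0 - a.1 1, a.1 1], (plane_facts a.2).1⟩ : ↥(box 3 (2 * N + 1))) ∧
          v z.1 = (⟨![-(b.1 0), b.1 0 - b.1 1, b.1 1], (plane_facts b.2).1⟩ : ↥(box 3 (2 * N + 1))) then (1 : ℝ) else 0)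
      (fun z _ => by positivity) (mem_univ ⟨⟨w, hwL⟩, hwD⟩)
    have hcond : u ⟨w, hwL⟩ = ⟨![-(a.1 0), a.1 0 - a.1 1, a.1 1], (plane_facts a.2).1⟩ ∧
        v ⟨w, hwL⟩ = ⟨![-(b.1 0), b.1 0 - b.1 1, b.1 1], (plane_facts b.2).1⟩ := by
      refine ⟨Subtype.ext ?_, Subtype.ext ?_⟩
      · rw [(huv _ hwD).1]
        exact hw1
      · rw [(huv _ hwD).2]
        show end2 w = ![-(b.1 0), b.1 0 - b.1 1, b.1 1]
        rw [hab]
        exact hw2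
    rw [if_pos hcond] at hle
    rw [hcE]
    dsimp only
    nlinarith
  -- the plane chart `E : box 2 N ≃ R`
  let E : ↥(box 2 N) ≃ {q : {a : ↥(box 3 (2 * N + 1)) // ¬ IsDec a.1} // PlaneIn q.1.1} :=
    { toFun := fun a => ⟨⟨⟨![-(a.1 0), a.1 0 - a.1 1, a.1 1], (plane_facts a.2).1⟩,
          not_isDec_of_height _ (height_plane a.1)⟩, (plane_facts a.2).2⟩
      invFun := fun r => ⟨![-(r.1.1.1 0), r.1.1.1 2], unplane_mem r.2⟩
      left_inv := fun a => Subtype.ext (stub_strongSeamOrder_partG_chart a.1)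
      right_inv := fun r => Subtype.ext (Subtype.ext (Subtype.ext (plane_unplane r.2.1))) }
  have hE0 : E.symm ⟨q0, h0P⟩ = ⟨0, h0p⟩ := by
    rw [Equiv.symm_apply_eq]
    refine Subtype.ext (Subtype.ext (Subtype.ext ?_))
    show (0 : Site 3) = ![-((0 : Site 2) 0), (0 : Site 2) 0 - (0 : Site 2) 1, (0 : Site 2) 1]
    ext i
    fin_cases i <;> simp
  have hEc : E.symm ⟨qc, hcP⟩ = ⟨p, hp⟩ := by
    rw [Equiv.symm_apply_eq]
    rfl
  -- (1) planar box bridge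
  have h1 : isingTwoPoint (zdGraph 2) (box 2 N) (PairIsing.decorK 2) 0 .free 0 p =
      PairIsing.gibbsAvg (fun a b : ↥(box 2 N) => if (zdGraph 2).Adj a.1 b.1 then PairIsing.decorK 2 / 2 else 0)
        (fun s => spinAt (⟨0, h0p⟩ : ↥(box 2 N)) s * spinAt (⟨p, hp⟩ : ↥(box 2 N)) s) :=
    (gibbsAvg_nn2_pair N (PairIsing.decorK 2) h0p hp).symm
  -- (2) Griffiths: planar n.n. couplings ≤ symmetrised chart pull-back of the effective couplings
  obtain ⟨A, hA⟩ := TwoCouplingGKS.exists_prod_spinAt_eq_spinProduct (univ : Finset (Fin 2))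
    (![⟨0, h0p⟩, ⟨p, hp⟩] : Fin 2 → ↥(box 2 N))
  have hobs2 : (fun s : SpinConfig ↥(box 2 N) =>
      spinAt (⟨0, h0p⟩ : ↥(box 2 N)) s * spinAt (⟨p, hp⟩ : ↥(box 2 N)) s) = spinProduct A := by
    rw [← hA]
    funext s
    simp [Fin.prod_univ_two]
  have h2 : PairIsing.gibbsAvg (fun a b : ↥(box 2 N) => if (zdGraph 2).Adj a.1 b.1 then PairIsing.decorK 2 / 2 else 0)
        (fun s => spinAt (⟨0, h0p⟩ : ↥(box 2 N)) s * spinAt (⟨p, hp⟩ : ↥(box 2 N)) s) ≤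
      PairIsing.gibbsAvg (fun a b => (cE a b + cE b a) / 2)
        (fun s => spinAt (⟨0, h0p⟩ : ↥(box 2 N)) s * spinAt (⟨p, hp⟩ : ↥(box 2 N)) s) := by
    rw [hobs2]
    refine TwoCouplingGKS.gibbsAvg_spinProduct_mono (fun a b => ?_) A
    have hab := hcE0 a b
    have hba := hcE0 b a
    by_cases hadj : (zdGraph 2).Adj a.1 b.1
    · rw [if_pos hadj, abs_of_nonneg (div_nonneg hβ₂ zero_le_two)]
      obtain ⟨i, hi | hi⟩ := (zdGraph_adj_iff _ _).1 hadj
      · have := hcE1 a b i hi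
        linarith
      · have := hcE1 b a i hi
        linarith
    · rw [if_neg hadj, abs_zero]
      linarith
  -- (3) symmetrisation, (4) transport along the chart, (5) marginalisation, (6) decoration–iteration
  have h3 := gibbsAvg_symmHalf cE (fun s => spinAt (⟨0, h0p⟩ : ↥(box 2 N)) s * spinAt (⟨p, hp⟩ : ↥(box 2 N)) s)
  have h4 : PairIsing.gibbsAvg cE (fun s => spinAt (⟨0, h0p⟩ : ↥(box 2 N)) s * spinAt (⟨p, hp⟩ : ↥(box 2 N)) s) =
      PairIsing.gibbsAvg (fun x y : {q : {a : ↥(box 3 (2 * N + 1)) // ¬ IsDec a.1} // PlaneIn q.1.1} => cQ x.1 y.1) gR := by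
    have hobs : (fun s : SpinConfig ↥(box 2 N) => gR (s ∘ E.symm)) =
        fun s => spinAt (⟨0, h0p⟩ : ↥(box 2 N)) s * spinAt (⟨p, hp⟩ : ↥(box 2 N)) s := by
      funext s
      simp only [hgR, spinAt, Function.comp_apply, hE0, hEc]
    have ht := PairIsing.gibbsAvg_comp_equiv E
      (fun x y : {q : {a : ↥(box 3 (2 * N + 1)) // ¬ IsDec a.1} // PlaneIn q.1.1} => cQ x.1 y.1) gR
    rw [hobs] at ht
    exact ht
  have h5 : PairIsing.gibbsAvg cQ g =
      PairIsing.gibbsAvg (fun x y : {q : {a : ↥(box 3 (2 * N + 1)) // ¬ IsDec a.1} // PlaneIn q.1.1} => cQ x.1 y.1) gR := by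
    refine EndpointIdentityProof.gibbsAvg_restrict (fun q : {a : ↥(box 3 (2 * N + 1)) // ¬ IsDec a.1} => PlaneIn q.1.1)
      cQ (fun q q' hqq' => ?_) g gR (fun ρ => rfl)
    rw [hcQ]
    dsimp only
    rw [Finset.sum_eq_zero fun z _ => ?_, mul_zero]
    refine if_neg fun hz => hqq' ?_
    have hP := (end_facts z.1.1 z.2).2.1
    rw [← (huv z.1 z.2).1, ← (huv z.1 z.2).2, hz.1, hz.2] at hP
    exact hP
  have h6 := gibbsAvg_decCoupling (D := fun a : ↥(box 3 (2 * N + 1)) => IsDec a.1) (u := u) (v := v) 2 huD hvD hune g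
  -- assemble
  calc isingTwoPoint (zdGraph 2) (box 2 N) (PairIsing.decorK 2) 0 .free 0 p = _ := h1
    _ ≤ _ := h2
    _ = _ := h3
    _ = _ := h4
    _ = _ := h5.symm
    _ = _ := h6.symm
    _ ≤ _ := le_rfl

end StrongSeamOrder

/-! ## The registered stub -/

open StrongSeamOrder in
/-- **(S) — PLANE ORDER AT STRONG SEAM COUPLING (`J* < ∞`)**, registered stub `stub_strongSeamOrder` of line
`seam_renewal` (crux `TwinThreshold`, stmt-CriticalPhenomena-16906), proved exactly as registered: there is a seam
coupling `J ≥ 0` (namely `J₀ = 2/β_c(3)`) at which the (111) reflection twin at bulk `β_c(3)` has plane long-range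
order, `inf_{c : h c = 0} sup_L ⟨σ₀σ_c⟩_{TW(J₀), box L} ≥ m > 0`. Proof: delete every bond except, for each
square-lattice bond of the plane (coordinates `(a,b) ↦ (-a, a-b, b)`), the two bonds of ONE decorating spin in layer
`∓1` (Griffiths), sum the decorations out (decoration–iteration, effective coupling
`½ log cosh(2 β_c J₀) = ½ log cosh 4`) to get the free nearest-neighbour square-lattice Ising model in the box
`[-N,N]²` at `β₂ = ½ log cosh 4 > β_c(2) = ½ log(1+√2)`, whose two-point function converges along boxes to
`⟨σ₀σ_p⟩^{free}_{β₂} = ⟨σ₀σ_p⟩⁺_{β₂} ≥ m*(β₂)² > 0` (BGJS duality identity, GKS, Onsager–Yang/Peierls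
positivity of `m*` above `β_c(2)`; all in tree).
[cite: FriedliVelenik2017, Exercise 3.31, p. 142] [cite: BenettinGallavottiJonaLasinioStella1973, §3, eq. (3.10)] -/
theorem stub_strongSeamOrder : open Literature.Probability.LatticeModels in ((fun (hZ : Site 3 → ℤ) => (fun (twinLat : ℝ → (k : ℕ) → (Fin k → Site 3) → ℝ) => (fun (LRO : ℝ → Prop) => ∃ J : ℝ, 0 ≤ J ∧ LRO J) (fun J : ℝ => ∃ m : ℝ, 0 < m ∧ ∀ c : Site 3, hZ c = 0 → m ≤ twinLat J 2 ![0, c])) (fun (J : ℝ) (k : ℕ) (z : Fin k → Site 3) => ⨆ L : ℕ, PairIsing.gibbsAvg (fun a b : ↥(box 3 L) => if (((∑ i, |a.1 i - b.1 i| = 1) ∧ ¬ ((a.1 0 + a.1 1 + a.1 2 = 0 ∧ b.1 0 + b.1 1 + b.1 2 = 1) ∨ (a.1 0 + a.1 1 + a.1 2 = 1 ∧ b.1 0 + b.1 1 + b.1 2 = 0))) ∨ (((a.1 0 + a.1 1 + a.1 2 = 0 ∧ b.1 0 + b.1 1 + b.1 2 = 1) ∨ (a.1 0 + a.1 1 +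 a.1 2 = 1 ∧ b.1 0 + b.1 1 + b.1 2 = 0)) ∧ ∃ i : Fin 3, a.1 + b.1 = Pi.single i 1)) then (criticalBeta 3 / 2) * (if a.1 0 + a.1 1 + a.1 2 = 0 ∨ b.1 0 + b.1 1 + b.1 2 = 0 then J else 1) else 0) (fun s => ∏ i, if h : z i ∈ box 3 L then spinAt (⟨z i, h⟩ : ↥(box 3 L)) s else 0))) (fun z : Site 3 => z 0 + z 1 + z 2)) := by
  obtain ⟨m, hm, hmle⟩ := stub_strongSeamOrder_partD_planarOrder
  refine ⟨2 / criticalBeta 3, (div_pos two_pos (criticalBeta_pos_holds (d := 3) (by norm_num))).le, m, hm,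
    fun c hc => ?_⟩
  have hc' : c 0 + c 1 + c 2 = 0 := hc
  have hpc := plane_unplane hc'
  refine (hmle ![-(c 0), c 2]).trans (twoPointFree_le_ciSup_of_box_le (PairIsing.decorK_nonneg 2) _ ?_
    (fun N => 2 * N + 1) ?_)
  · refine ⟨1, ?_⟩
    rintro _ ⟨L, rfl⟩
    exact (le_abs_self _).trans (TwoCouplingGKS.abs_gibbsAvg_le_one _ fun s => abs_twinObs_le_one _ s)
  · filter_upwards [eventually_mem_box (![-(c 0), c 2] : Site 2)] with N hN
    have h := isingTwoPoint_le_twin N hN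
    rw [hpc] at h
    exact h

end Summit.CriticalPhenomena.Ising3DConformalLimit.Cruxes.TwinThreshold.SeamRenewal

end
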